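import Literature.NumberTheory.EllipticCurves.IsogenyGroundFieldExtension
import Literature.NumberTheory.EllipticCurves.IsogenyQuotientCurveProofs
import Literature.NumberTheory.EllipticCurves.OpenImageMazurProofs
import Summits.BirchSwinnertonDyer.Rank1Residual.LW16.IsogenyKummerDegenerationRational
import HarnessLib

/-!
# The `p`-isogeny edge dichotomy at REDUCIBLE `E[p]`, from the binders of the GAP-target
# (`W/ℚ`, `¬ W.HasIrreducibleModPGaloisRep p`, a number field `K`, `P ∈ E(K)`)

Third file of the kernel lemma of record for sheet D-AUDIT-lw16-r1 §2.3 (i) / §7 (c) and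
D-AUDIT-lw16-r2 §4 (cell `bsd-litref/lw16`, tranche T3, typer seat `bsd-litref-lw16-ty`):
`LW16/IsogenyKummerDegeneration.lean` (p465503) proves the dichotomy for isogenies
`φ : E → E'`, `ψ : E' → E` over a field `F` with `ψ ∘ φ = [p]` on `Γ_F`-fixed geometric points;
`LW16/IsogenyKummerDegenerationRational.lean` (p466271, p466682) restates it with `F`-RATIONAL data
`P : W.toAffine.Point`, `¬ IsOfFinAddOrder P`, `¬ p ∣ [E(F) : ℤP]`. What was left
(HOME/HANDOFF § bsd-litref-lw16-ty, UPDATE 2: "except the base change of a `ℚ`-isogeny to `K`") is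
supplied here, so that the dichotomy is available from EXACTLY the binders of the typed targets
`LW16.KolyvaginCertificateReducible` / `LW16.GJPST2009Thm37` (p459666): an elliptic curve `W/ℚ`
with `E[p]` reducible (`¬ W.HasIrreducibleModPGaloisRep p`, `p` prime), a number field `K`, and a
point `P : (W.baseChange K).toAffine.Point` of infinite order with `p ∤ [E(K) : ℤP]`.

* `extendScalars_comp_apply_eq_zsmul` — a composition identity `ψ (φ P) = m • P` over `K`
  survives extension of the ground field to an algebraic `L/K` (`Isogeny.extendScalars`,
  file `IsogenyGroundFieldExtension`): `ψ_L (φ_L Q) = m • Q` on `E_L(L̄)`.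
* `exists_isogeny_comp_eq_prime_smul_of_not_irreducible` — reducible `E[p]` over `ℚ` gives a
  `ℚ`-isogeny edge `φ : E → E' = E/C`, `ψ = φ̂ : E' → E` with `deg φ = p`, `ψφ = [p]`, `φψ = [p]`
  (the `Γ_ℚ`-stable line `C ⊂ E[p]` of `Mazur1978.not_hasIrreducibleModPGaloisRep_iff_exists_natCard_eq`
  is the kernel of the quotient isogeny: Silverman *AEC* III.4.12 / 4.13.2 / III.6.1–6.2, the tree's
  PROVED `exists_isogeny_ker_eq_and_comp_eq_nsmul_holds`).
* `exists_isogeny_baseChange_comp_eq_prime_smul_of_not_irreducible` — the same edge over any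
  algebraic extension `K/ℚ` (`E_K ⇄ E'_K`, still `ψφ = [p] = φψ`, `deg = p`).
* `exists_isogeny_baseChange_root_xor_generates_of_not_irreducible` — THE ASSEMBLED STATEMENT: for
  `W/ℚ` elliptic with `E[p]` reducible and `K` a number field there are `W'/ℚ` elliptic,
  `ℚ`-isogenous to `W`, and a `p`-isogeny edge `φ : E_K → E'_K`, `ψ : E'_K → E_K` (`ψφ = [p] = φψ`)
  such that for every `P ∈ E(K)` of infinite order with `p ∤ [E(K) : ℤP]` and every `P' ∈ E'(K)`
  with `p ∤ [E'(K) : ℤP']`, EXACTLY ONE of (A) `P` has a `p`-th root `Q ∈ E(K̄)` with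
  `σQ − Q ∈ ker φ` for all `σ ∈ Γ_K` (the Kummer extension `K(E[p], P/p)/K(E[p])` degenerates
  inside `ker φ`; the conclusion of Gross 1991 Prop. 9.3 for `S = ⟨δP⟩` fails), (B)
  `E'(K) = ℤφ(P) + pE'(K)`. The reversed edge `(ψ, φ)` satisfies the same hypotheses, so
  `exists_root_xor_generates_of_not_dvd_index_point ψ φ …` gives the dichotomy at the other end.
* `dvd_index_zmultiples_prime_smul`, `dvd_index_map_of_exists_root`,
  `dvd_index_of_exists_root_point`, `exists_root_iff_dvd_index_point`,
  `exists_isogeny_baseChange_exists_root_iff_dvd_index_of_not_irreducible` — Case (A) in INDEX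
  currency (sheet D-AUDIT-lw16-r1 §2.3 (i): `#coker(φ_*) = p` in Case A; §4 (c): the engine's
  orientation bit): under the certificate on `P` and with `P₁ = φ(P)` of finite index,
  Case (A) ⟺ `p ∣ [E′(F) : ℤP₁]`, Case (B) ⟺ `p ∤ [E′(F) : ℤP₁]`.

Theorems only; no `def`, no named fact, nothing here proves BSD for any pair (HONEST FRAMING of the
cell: the flag `LW16-Thm14-disputed-MN19-0.11` is CONFIRMED by both readers; these lemmas make the
footnote's "because" a kernel statement on the target's own binders). Sources: Silverman, *AEC*,
III.4.12, III.6.1–6.2, VIII.§1 [cite: SilvermanAEC2009, III.4 Prop. 4.12 and Remark 4.13.2];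
B. Mazur, Invent. Math. 44 (1978), Introduction pp. 129–130 (rational isogenies = stable lines)
[cite: Mazur1978, Thm 1 (Introduction, pp. 129–130)]; B. H. Gross, *Kolyvagin's work on modular
elliptic curves* (1991), Prop. 9.3; A. Matar, J. Nekovář, JTNB 31 (2019), Prop. 6.4 (C5)/(C6).
-/

noncomputable section

open scoped Classical
open WeierstrassCurve Field Literature.NumberTheory.GaloisRepresentations
  Literature.NumberTheory.EllipticCurves

universe u

namespace Summit.BirchSwinnertonDyer.Rank1Residual.LW16.IsogenyEdge

/-! ### A composition identity survives extension of the ground field -/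

/-- **`ψφ = [m]` over `K` ⇒ `ψ_L φ_L = [m]` over `L`.** For isogenies `φ : E → E'`, `ψ : E' → E`
over `K` with `ψ (φ P) = m • P` on `E(K̄)` and an algebraic extension `L/K`, the extended isogenies
(`Isogeny.extendScalars L`, i.e. `ι_* ∘ φ ∘ ι_*⁻¹` along the tree's `ι = absClosureEquiv K L :
K̄ ≃ₐ[K] L̄`) satisfy `ψ_L (φ_L Q) = m • Q` on `E_L(L̄)`. Silverman, *AEC*, III.§4 (an isogeny over
`K` is a morphism over `K̄`; `[m]` is defined over the prime field). [folklore] -/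
theorem extendScalars_comp_apply_eq_zsmul {K : Type u} [Field K] {W W' : WeierstrassCurve K}
    (L : Type u) [Field L] [Algebra K L] [Algebra.IsAlgebraic K L]
    (φ : Isogeny W W') (ψ : Isogeny W' W) (m : ℤ) (h : ∀ P, ψ (φ P) = m • P)
    (Q : (W.baseChange L).geomPoints) :
    (ψ.extendScalars L) ((φ.extendScalars L) Q) = m • Q := by
  obtain ⟨P, rfl⟩ := (W.geomPointsExtend L (absClosureEquiv K L)).surjective Q
  show (ψ.extendScalarsOfAlgEquiv (absClosureEquiv K L))
      ((φ.extendScalarsOfAlgEquiv (absClosureEquiv K L)) (W.geomPointsExtend L (absClosureEquiv K L) P)) =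
    m • W.geomPointsExtend L (absClosureEquiv K L) P
  rw [Isogeny.extendScalarsOfAlgEquiv_apply_geomPointsExtend,
    Isogeny.extendScalarsOfAlgEquiv_apply_geomPointsExtend, h, map_zsmul]

/-! ### Reducible `E[p]` over `ℚ` ⇒ a `p`-isogeny edge `E ⇄ E'` with `ψφ = [p] = φψ` -/

/-- **Reducible `E[p]` gives a `ℚ`-rational `p`-isogeny edge.** For `W/ℚ` elliptic and `p` prime
with `ρ̄_{E,p}` reducible there are an elliptic curve `W'/ℚ` and isogenies `φ : E → E'`,
`ψ : E' → E` over `ℚ` with `deg φ = p`, `ψ (φ P) = p • P` on `E(ℚ̄)` and `φ (ψ Q) = p • Q` on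
`E'(ℚ̄)`: a `Γ_ℚ`-stable line `C ⊂ E[p]` (`#C = p`,
`Mazur1978.not_hasIrreducibleModPGaloisRep_iff_exists_natCard_eq`) is the kernel of the quotient
isogeny `E → E/C` over `ℚ`, and `ψ` is its dual (Silverman, *AEC*, Prop. III.4.12 with
Rem. III.4.13.2, Thm. III.6.1(a), III.6.2(a); the tree's PROVED
`exists_isogeny_ker_eq_and_comp_eq_nsmul_holds`). (Same construction as
`EisensteinPrimes.exists_isogeny_degree_eq_of_red`, which keeps only `φ` and its degree.)
[cite: SilvermanAEC2009, III.4 Prop. 4.12 and Remark 4.13.2] -/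
theorem exists_isogeny_comp_eq_prime_smul_of_not_irreducible (W : WeierstrassCurve ℚ)
    [W.IsElliptic] {p : ℕ} [Fact p.Prime] (hred : ¬ W.HasIrreducibleModPGaloisRep p) :
    ∃ (W' : WeierstrassCurve ℚ) (_ : W'.IsElliptic) (φ : Isogeny W W') (ψ : Isogeny W' W),
      φ.degree = p ∧ (∀ P, ψ (φ P) = (p : ℤ) • P) ∧ ∀ Q, φ (ψ Q) = (p : ℤ) • Q := by
  have hp : p.Prime := Fact.out
  haveI : NeZero (p : ℚ) := ⟨Nat.cast_ne_zero.mpr hp.ne_zero⟩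
  obtain ⟨H, hHstab, hHcard⟩ :=
    (Mazur1978.not_hasIrreducibleModPGaloisRep_iff_exists_natCard_eq W p).mp hred
  set S : AddSubgroup W.geomPoints := H.map (geomTorsion W (p : ℤ)).subtype with hS
  have hScard : Nat.card S = p := by
    rw [← hHcard]
    exact Nat.card_congr (H.equivMapOfInjective _ (geomTorsion W (p : ℤ)).subtype_injective).symm
  have hSfin : (S : Set W.geomPoints).Finite :=
    Nat.finite_of_card_ne_zero (hScard ▸ hp.ne_zero)
  have hSstab : ∀ (σ : absoluteGaloisGroup ℚ) (P : W.geomPoints), P ∈ S → σ • P ∈ S := by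
    rintro σ P ⟨Q, hQ, rfl⟩
    exact ⟨σ • Q, hHstab σ Q hQ, rfl⟩
  obtain ⟨W', hW', g, f, hker, hfg, hgf⟩ :=
    W.exists_isogeny_ker_eq_and_comp_eq_nsmul_holds S hSfin hSstab
  refine ⟨W', hW', g, f, ?_, fun P ↦ ?_, fun Q ↦ ?_⟩
  · change Nat.card g.toAddMonoidHom.ker = p
    rw [hker, hScard]
  · rw [hfg, hScard, natCast_zsmul]
  · rw [hgf, hScard, natCast_zsmul]

/-- **The edge over `K`.** For `W/ℚ` elliptic with `ρ̄_{E,p}` reducible (`p` prime) and any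
algebraic extension `K/ℚ` there are `W'/ℚ` elliptic with `W ∼_ℚ W'` and isogenies
`φ : E_K → E'_K`, `ψ : E'_K → E_K` over `K` with `deg φ = p`, `ψφ = [p]` on `E_K(K̄)` and
`φψ = [p]` on `E'_K(K̄)` — the `ℚ`-rational edge of
`exists_isogeny_comp_eq_prime_smul_of_not_irreducible` extended to `K` (`Isogeny.extendScalars`,
`degree_extendScalars`, `extendScalars_comp_apply_eq_zsmul`). Silverman, *AEC*, III.§4 (an isogeny
defined over `ℚ` is defined over `K`). [cite: SilvermanAEC2009, III.4 Prop. 4.12 and Remark 4.13.2] -/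
theorem exists_isogeny_baseChange_comp_eq_prime_smul_of_not_irreducible (W : WeierstrassCurve ℚ)
    [W.IsElliptic] {p : ℕ} [Fact p.Prime] (hred : ¬ W.HasIrreducibleModPGaloisRep p)
    (K : Type) [Field K] [CharZero K] [Algebra.IsAlgebraic ℚ K] :
    ∃ (W' : WeierstrassCurve ℚ) (_ : W'.IsElliptic), IsIsogenous W W' ∧
      ∃ (φ : Isogeny (W.baseChange K) (W'.baseChange K))
        (ψ : Isogeny (W'.baseChange K) (W.baseChange K)),
        φ.degree = p ∧ (∀ Q, ψ (φ Q) = (p : ℤ) • Q) ∧ ∀ Q', φ (ψ Q') = (p : ℤ) • Q' := by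
  obtain ⟨W', hW', g, f, hdeg, hfg, hgf⟩ :=
    exists_isogeny_comp_eq_prime_smul_of_not_irreducible W hred
  exact ⟨W', hW', ⟨g⟩, g.extendScalars K, f.extendScalars K,
    (Isogeny.degree_extendScalars K g).trans hdeg,
    extendScalars_comp_apply_eq_zsmul K g f p hfg, extendScalars_comp_apply_eq_zsmul K f g p hgf⟩

/-! ### The assembled dichotomy on the binders of `LW16.KolyvaginCertificateReducible` -/

/-- **The `p`-isogeny edge dichotomy at reducible `E[p]`, from the GAP-target's binders.** Let
`W/ℚ` be an elliptic curve with `ρ̄_{E,p}` REDUCIBLE (`p` prime) and `K` a number field (in the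
targets: the Heegner field). Then there are an elliptic curve `W'/ℚ`, `ℚ`-isogenous to `W`, and a
`p`-isogeny edge `φ : E_K → E'_K`, `ψ : E'_K → E_K` over `K` (`deg φ = p`, `ψφ = [p] = φψ`) such
that for every `P ∈ E(K)` of infinite order with `p ∤ [E(K) : ℤP]` (the `m₀ = 0` certificate,
`P = y_K`) and every `P' ∈ E'(K)` with `p ∤ [E'(K) : ℤP']`, EXACTLY ONE of:
(A) `P` has a `p`-th root `Q ∈ E(K̄)` with `σQ − Q ∈ ker φ` for all `σ ∈ Γ_K` — the Kummer
extension `K(E[p], P/p)/K(E[p])` has group inside the line `ker φ`, so `Gal(L(P/p)/L) ≅ E_p`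
(Gross 1991 Prop. 9.3 for `S = ⟨δP⟩`, whose printed proof uses "`E_p` is a simple `𝒢`-module" =
Matar–Nekovář (C5)) is FALSE at this pair; (B) `E'(K) = ℤφ(P) + pE'(K)`.
By `exists_root_xor_generates_of_not_dvd_index_point` (p466271) on the edge of
`exists_isogeny_baseChange_comp_eq_prime_smul_of_not_irreducible`; the reversed edge `(ψ, φ)`
satisfies the same hypotheses (apply that theorem to `ψ φ` for the dichotomy at `E'`). Sheet
D-AUDIT-lw16-r1 §2.3 (i) («Gal(L(y_K/p)/L) ↪ ker φ on one end of every p-isogeny edge»), r2 §4.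
[cite: SilvermanAEC2009, III.4 Prop. 4.12 and Remark 4.13.2] -/
theorem exists_isogeny_baseChange_root_xor_generates_of_not_irreducible (W : WeierstrassCurve ℚ)
    [W.IsElliptic] {p : ℕ} [Fact p.Prime] (hred : ¬ W.HasIrreducibleModPGaloisRep p)
    (K : Type) [Field K] [NumberField K] :
    ∃ (W' : WeierstrassCurve ℚ) (_ : W'.IsElliptic), IsIsogenous W W' ∧
      ∃ (φ : Isogeny (W.baseChange K) (W'.baseChange K))
        (ψ : Isogeny (W'.baseChange K) (W.baseChange K)),
        φ.degree = p ∧ (∀ Q, ψ (φ Q) = (p : ℤ) • Q) ∧ (∀ Q', φ (ψ Q') = (p : ℤ) • Q') ∧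
        ∀ (P : (W.baseChange K).toAffine.Point), ¬ IsOfFinAddOrder P →
          ¬ p ∣ (AddSubgroup.zmultiples P).index →
          ∀ (P' : (W'.baseChange K).toAffine.Point), ¬ p ∣ (AddSubgroup.zmultiples P').index →
            Xor (∃ Q : geomPoints (W.baseChange K), (p : ℤ) • Q = toGeomPoints (W.baseChange K) P ∧
                ∀ σ : absoluteGaloisGroup K, σ • Q - Q ∈ φ.toAddMonoidHom.ker)
              (∀ a' : (W'.baseChange K).toAffine.Point,
                ∃ (n : ℤ) (b' : (W'.baseChange K).toAffine.Point),
                  toGeomPoints (W'.baseChange K) a' =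
                    n • φ (toGeomPoints (W.baseChange K) P) +
                      (p : ℤ) • toGeomPoints (W'.baseChange K) b') := by
  have hp : p.Prime := Fact.out
  obtain ⟨W', hW', hiso, φ, ψ, hdeg, hψφ, hφψ⟩ :=
    exists_isogeny_baseChange_comp_eq_prime_smul_of_not_irreducible W hred K
  haveI := hW'
  haveI : (W.baseChange K).IsElliptic := inferInstanceAs (W.map (algebraMap ℚ K)).IsElliptic
  haveI : (W'.baseChange K).IsElliptic := inferInstanceAs (W'.map (algebraMap ℚ K)).IsElliptic
  exact ⟨W', hW', hiso, φ, ψ, hdeg, hψφ, hφψ, fun P hP hidx P' hidx' ↦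
    exists_root_xor_generates_of_not_dvd_index_point φ ψ hp hψφ P hP hidx P' hidx'⟩

/-- **In Case B the certificate moves to `E'` with the point `φ(P)`; in either case `φ(P)`'s own
Kummer extension degenerates inside `ker ψ`.** On the edge of
`exists_isogeny_baseChange_root_xor_generates_of_not_irreducible`: `φ(P)` is a `K`-rational point
`P₁` of `E'` (`exists_point_toGeomPoints_eq_map`), it always has a `p`-th root `Q'` with
`σQ' − Q' ∈ ker ψ` for all `σ ∈ Γ_K` (`exists_root_map_toGeomPoints`), and if Case (B) holds and
`[E'(K) : ℤP₁]` is finite then `p ∤ [E'(K) : ℤP₁]` (`not_dvd_index_of_generates_point`) — so at the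
vertex `E'` the certificate hypothesis holds with `P₁` while alternative (A) holds for `P₁` and the
edge `ψ`. Sheet D-AUDIT-lw16-r1 §2.3 (i), §4 (c). [folklore] -/
theorem exists_point_map_root_and_not_dvd_index_of_generates {K : Type u} [Field K]
    [PerfectField K] {V V' : WeierstrassCurve K} [V.IsElliptic] [V'.IsElliptic] (φ : Isogeny V V') (ψ : Isogeny V' V) {p : ℕ}
    (hp : p.Prime) (hφψ : ∀ Q', φ (ψ Q') = (p : ℤ) • Q') (P : V.toAffine.Point) :
    ∃ P₁ : V'.toAffine.Point, toGeomPoints V' P₁ = φ (toGeomPoints V P) ∧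
      (∃ Q' : geomPoints V', (p : ℤ) • Q' = toGeomPoints V' P₁ ∧
        ∀ σ : absoluteGaloisGroup K, σ • Q' - Q' ∈ ψ.toAddMonoidHom.ker) ∧
      ((AddSubgroup.zmultiples P₁).index ≠ 0 →
        (∀ a' : V'.toAffine.Point, ∃ (n : ℤ) (b' : V'.toAffine.Point),
          toGeomPoints V' a' = n • φ (toGeomPoints V P) + (p : ℤ) • toGeomPoints V' b') →
        ¬ p ∣ (AddSubgroup.zmultiples P₁).index) := by
  obtain ⟨P₁, hP₁⟩ := exists_point_toGeomPoints_eq_map φ P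
  obtain ⟨Q', hQ', hσ⟩ := exists_root_map_toGeomPoints φ ψ (p : ℤ) hφψ P
  exact ⟨P₁, hP₁, ⟨Q', hQ'.trans hP₁.symm, hσ⟩,
    fun hfin hB ↦ not_dvd_index_of_generates_point hp φ P P₁ hP₁ hfin hB⟩


/-! ### Case A in index currency: `p ∣ [E'(F) : ℤφ(P)]` (the orientation bit of the edge)

Sheet D-AUDIT-lw16-r1 §2.3 (i) prints the index bookkeeping along a `p`-isogeny edge as
`[E′(K) : ℤφ(y_K)] = [E(K) : ℤy_K] · #coker(φ_*)` with `#coker(φ_*) ∈ {1, p}`, `= p` in Case A;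
§4 (c) asks the engine seat for the ORIENTATION diagnostic "is `φ(y_K)` `p`-divisible in `E′(K)`".
The theorems below identify that bit with the Kummer side: under the certificate on `P`, Case (A)
holds iff `p ∣ [E′(F) : ℤφ(P)]`, Case (B) iff `p ∤ [E′(F) : ℤφ(P)]` (finite index). Pure algebra
plus `exists_root_iff_exists_fixed_apply_eq` (p465503); no fact. -/

section IndexCurrency

variable {A : Type*} [AddCommGroup A]

/-- **`p ∣ [A : ℤ(p R)]` for `R` of infinite order** (`p` prime; index `0`, i.e. divisible by
`p`, when `A/ℤ(pR)` is infinite): the class of `R` in `A/ℤ(pR)` has order exactly `p`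
(`k(pR) = R` would make `R` torsion), and the order of an element divides the cardinality.
[folklore] -/
theorem dvd_index_zmultiples_prime_smul {p : ℕ} (hp : p.Prime) {R : A} (hR : ¬ IsOfFinAddOrder R) :
    p ∣ (AddSubgroup.zmultiples ((p : ℤ) • R)).index := by
  haveI : Fact p.Prime := ⟨hp⟩
  set H := AddSubgroup.zmultiples ((p : ℤ) • R) with hH
  have hord : addOrderOf (R : A ⧸ H) = p := by
    apply addOrderOf_eq_prime
    · rw [← QuotientAddGroup.mk_nsmul, QuotientAddGroup.eq_zero_iff, ← natCast_zsmul]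
      exact AddSubgroup.mem_zmultiples _
    · intro h
      rw [QuotientAddGroup.eq_zero_iff, AddSubgroup.mem_zmultiples_iff] at h
      obtain ⟨k, hk⟩ := h
      refine hR (isOfFinAddOrder_iff_zsmul_eq_zero.mpr ⟨k * p - 1, ?_, ?_⟩)
      · intro hkp
        have h1 : (p : ℤ) ∣ 1 := ⟨k, by linarith⟩
        exact hp.one_lt.ne' (Nat.dvd_one.mp (Int.natCast_dvd_natCast.mp h1))
      · rw [sub_smul, one_smul, mul_smul, hk, sub_self]
  rw [AddSubgroup.index, ← hord]
  exact addOrderOf_dvd_natCard _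

end IndexCurrency

section EdgeIndex

variable {F : Type u} [Field F] {V V' : WeierstrassCurve F} [V.IsElliptic] [V'.IsElliptic]

/-- **Case A ⇒ `φ(y) ∈ pE′(F)` ⇒ `p ∣ [E′(F) : ℤφ(y)]`** (geometric `Γ_F`-fixed points). On an
edge `φ : E → E′`, `ψ : E′ → E` with `ψφ = [p]`, `φψ = [p]`: if `y ∈ E(F)` has infinite order and
a `p`-th root `Q` with `σQ − Q ∈ ker φ` for all `σ ∈ Γ_F`, then `y = ψ(y′)` with `y′ ∈ E′(F)`
(`exists_root_iff_exists_fixed_apply_eq`), so `φ(y) = p · y′` with `y′` of infinite order, and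
`p ∣ [E′(F) : ℤφ(y)]` (`dvd_index_zmultiples_prime_smul`). Sheet D-AUDIT-lw16-r1 §2.3 (i)
(`#coker(φ_*) = p` in Case A). [folklore] -/
theorem dvd_index_map_of_exists_root (φ : Isogeny V V') (ψ : Isogeny V' V) {p : ℕ} (hp : p.Prime)
    (hψφ : ∀ P, ψ (φ P) = (p : ℤ) • P) (hφψ : ∀ P', φ (ψ P') = (p : ℤ) • P')
    (y : FixedPoints.addSubgroup (absoluteGaloisGroup F) (geomPoints V))
    (hyord : ¬ IsOfFinAddOrder y)
    (hA : ∃ Q : geomPoints V, (p : ℤ) • Q = y ∧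
      ∀ σ : absoluteGaloisGroup F, σ • Q - Q ∈ φ.toAddMonoidHom.ker) :
    p ∣ (AddSubgroup.zmultiples (⟨φ y, map_mem_fixedPoints φ y.2⟩ :
      FixedPoints.addSubgroup (absoluteGaloisGroup F) (geomPoints V'))).index := by
  obtain ⟨y', hy', hψy'⟩ := (exists_root_iff_exists_fixed_apply_eq φ ψ (p : ℤ) hψφ y).mp hA
  have hφy : φ (y : geomPoints V) = (p : ℤ) • y' := by rw [← hψy', hφψ]
  have hy'ord : ¬ IsOfFinAddOrder
      (⟨y', hy'⟩ : FixedPoints.addSubgroup (absoluteGaloisGroup F) (geomPoints V')) := by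
    intro hfin
    apply hyord
    have h1 : IsOfFinAddOrder y' := by
      have h := ((AddSubgroupClass.subtype_injective
        (FixedPoints.addSubgroup (absoluteGaloisGroup F) (geomPoints V'))).isOfFinAddOrder_iff
          (x := (⟨y', hy'⟩ :
            FixedPoints.addSubgroup (absoluteGaloisGroup F) (geomPoints V')))).mpr hfin
      exact h
    have h2 : IsOfFinAddOrder (y : geomPoints V) := by
      rw [← hψy']
      exact ψ.toAddMonoidHom.isOfFinAddOrder h1
    exact ((AddSubgroupClass.subtype_injective
      (FixedPoints.addSubgroup (absoluteGaloisGroup F) (geomPoints V))).isOfFinAddOrder_iff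
        (x := y)).mp h2
  have heq : (⟨φ y, map_mem_fixedPoints φ y.2⟩ :
      FixedPoints.addSubgroup (absoluteGaloisGroup F) (geomPoints V')) = (p : ℤ) • ⟨y', hy'⟩ :=
    Subtype.ext (by simpa using hφy)
  rw [heq]
  exact dvd_index_zmultiples_prime_smul hp hy'ord

/-- **Case A ⇒ `p ∣ [E′(F) : ℤP₁]` for the `F`-rational point `P₁ = φ(P)`** (binders' currency):
`P ∈ E(F)` of infinite order, `P₁ ∈ E′(F)` with `toGeomPoints V' P₁ = φ (toGeomPoints V P)`
(`exists_point_toGeomPoints_eq_map`), Case (A) for `P` ⇒ `p ∣ [E′(F) : ℤP₁]`. [folklore] -/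
theorem dvd_index_of_exists_root_point [PerfectField F] (φ : Isogeny V V') (ψ : Isogeny V' V)
    {p : ℕ} (hp : p.Prime) (hψφ : ∀ P, ψ (φ P) = (p : ℤ) • P)
    (hφψ : ∀ P', φ (ψ P') = (p : ℤ) • P') (P : V.toAffine.Point) (hP : ¬ IsOfFinAddOrder P)
    (P₁ : V'.toAffine.Point) (hP₁ : toGeomPoints V' P₁ = φ (toGeomPoints V P))
    (hA : ∃ Q : geomPoints V, (p : ℤ) • Q = toGeomPoints V P ∧
      ∀ σ : absoluteGaloisGroup F, σ • Q - Q ∈ φ.toAddMonoidHom.ker) :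
    p ∣ (AddSubgroup.zmultiples P₁).index := by
  have h := dvd_index_map_of_exists_root φ ψ hp hψφ hφψ
    ⟨toGeomPoints V P, toGeomPoints_mem_fixedPoints_addSubgroup P⟩
    (by rwa [isOfFinAddOrder_toGeomPoints_iff]) hA
  have heq : (⟨φ (toGeomPoints V P), map_mem_fixedPoints φ
        (toGeomPoints_mem_fixedPoints_addSubgroup P)⟩ :
      FixedPoints.addSubgroup (absoluteGaloisGroup F) (geomPoints V')) =
      ⟨toGeomPoints V' P₁, toGeomPoints_mem_fixedPoints_addSubgroup P₁⟩ := Subtype.ext hP₁.symm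
  rwa [heq, index_zmultiples_toGeomPoints] at h

/-- **The orientation bit decides the end.** On a `p`-isogeny edge `φ : E → E′`, `ψ : E′ → E`
over a perfect field `F` (`ψφ = [p] = φψ`, `p` prime) with a certificate point `P ∈ E(F)`
(infinite order, `p ∤ [E(F) : ℤP]`), some `P′ ∈ E′(F)` with `p ∤ [E′(F) : ℤP′]`, and
`P₁ = φ(P) ∈ E′(F)` of finite index: Case (A) (`P`'s Kummer extension degenerates inside `ker φ`)
holds IFF `p ∣ [E′(F) : ℤP₁]`, and Case (B) (`E′(F) = ℤφ(P) + pE′(F)`) IFF `p ∤ [E′(F) : ℤP₁]`.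
So the engine's orientation column ("is `φ(y_K)` `p`-divisible in `E′(K)`", sheet D-AUDIT-lw16-r1
§4 (c)) names the end of the edge at which Gross 1991 Prop. 9.3's conclusion fails.
(`exists_root_xor_generates_of_not_dvd_index_point`, `dvd_index_of_exists_root_point`,
`not_dvd_index_of_generates_point`.) [folklore] -/
theorem exists_root_iff_dvd_index_point [PerfectField F] (φ : Isogeny V V') (ψ : Isogeny V' V)
    {p : ℕ} (hp : p.Prime) (hψφ : ∀ P, ψ (φ P) = (p : ℤ) • P)
    (hφψ : ∀ P', φ (ψ P') = (p : ℤ) • P') (P : V.toAffine.Point) (hP : ¬ IsOfFinAddOrder P)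
    (hidx : ¬ p ∣ (AddSubgroup.zmultiples P).index)
    (P' : V'.toAffine.Point) (hidx' : ¬ p ∣ (AddSubgroup.zmultiples P').index)
    (P₁ : V'.toAffine.Point) (hP₁ : toGeomPoints V' P₁ = φ (toGeomPoints V P))
    (hfin : (AddSubgroup.zmultiples P₁).index ≠ 0) :
    ((∃ Q : geomPoints V, (p : ℤ) • Q = toGeomPoints V P ∧
        ∀ σ : absoluteGaloisGroup F, σ • Q - Q ∈ φ.toAddMonoidHom.ker) ↔
      p ∣ (AddSubgroup.zmultiples P₁).index) ∧
    ((∀ a' : V'.toAffine.Point, ∃ (n : ℤ) (b' : V'.toAffine.Point),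
        toGeomPoints V' a' = n • φ (toGeomPoints V P) + (p : ℤ) • toGeomPoints V' b') ↔
      ¬ p ∣ (AddSubgroup.zmultiples P₁).index) := by
  have hx := exists_root_xor_generates_of_not_dvd_index_point φ ψ hp hψφ P hP hidx P' hidx'
  have hAI := fun hA ↦ dvd_index_of_exists_root_point φ ψ hp hψφ hφψ P hP P₁ hP₁ hA
  have hBI := fun hB ↦ not_dvd_index_of_generates_point hp φ P P₁ hP₁ hfin hB
  refine ⟨⟨hAI, fun hI ↦ ?_⟩, ⟨hBI, fun hnI ↦ ?_⟩⟩
  · rcases hx with ⟨hA, -⟩ | ⟨hB, -⟩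
    · exact hA
    · exact absurd hI (hBI hB)
  · rcases hx with ⟨hA, -⟩ | ⟨hB, -⟩
    · exact absurd (hAI hA) hnI
    · exact hB

end EdgeIndex

/-- **The orientation bit on the target's binders.** For `W/ℚ` elliptic with `ρ̄_{E,p}` reducible
and `K` a number field, on the edge `E_K ⇄ E′_K` of
`exists_isogeny_baseChange_root_xor_generates_of_not_irreducible`: for every certificate point
`P ∈ E(K)` (`¬ IsOfFinAddOrder P`, `p ∤ [E(K) : ℤP]`), every `P′ ∈ E′(K)` with `p ∤ [E′(K) : ℤP′]`
and the `K`-rational image `P₁ = φ(P)` of finite index, Case (A) ⟺ `p ∣ [E′(K) : ℤP₁]` and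
Case (B) ⟺ `p ∤ [E′(K) : ℤP₁]`. Sheet D-AUDIT-lw16-r1 §2.3 (i) / §4 (c). [folklore] -/
theorem exists_isogeny_baseChange_exists_root_iff_dvd_index_of_not_irreducible
    (W : WeierstrassCurve ℚ) [W.IsElliptic] {p : ℕ} [Fact p.Prime]
    (hred : ¬ W.HasIrreducibleModPGaloisRep p) (K : Type) [Field K] [NumberField K] :
    ∃ (W' : WeierstrassCurve ℚ) (_ : W'.IsElliptic), IsIsogenous W W' ∧
      ∃ (φ : Isogeny (W.baseChange K) (W'.baseChange K))
        (ψ : Isogeny (W'.baseChange K) (W.baseChange K)),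
        φ.degree = p ∧ (∀ Q, ψ (φ Q) = (p : ℤ) • Q) ∧ (∀ Q', φ (ψ Q') = (p : ℤ) • Q') ∧
        ∀ (P : (W.baseChange K).toAffine.Point), ¬ IsOfFinAddOrder P →
          ¬ p ∣ (AddSubgroup.zmultiples P).index →
          ∀ (P' : (W'.baseChange K).toAffine.Point), ¬ p ∣ (AddSubgroup.zmultiples P').index →
          ∀ (P₁ : (W'.baseChange K).toAffine.Point),
            toGeomPoints (W'.baseChange K) P₁ = φ (toGeomPoints (W.baseChange K) P) →
            (AddSubgroup.zmultiples P₁).index ≠ 0 →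
            ((∃ Q : geomPoints (W.baseChange K), (p : ℤ) • Q = toGeomPoints (W.baseChange K) P ∧
                ∀ σ : absoluteGaloisGroup K, σ • Q - Q ∈ φ.toAddMonoidHom.ker) ↔
              p ∣ (AddSubgroup.zmultiples P₁).index) ∧
            ((∀ a' : (W'.baseChange K).toAffine.Point,
                ∃ (n : ℤ) (b' : (W'.baseChange K).toAffine.Point),
                  toGeomPoints (W'.baseChange K) a' =
                    n • φ (toGeomPoints (W.baseChange K) P) +
                      (p : ℤ) • toGeomPoints (W'.baseChange K) b') ↔
              ¬ p ∣ (AddSubgroup.zmultiples P₁).index) := by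
  have hp : p.Prime := Fact.out
  obtain ⟨W', hW', hiso, φ, ψ, hdeg, hψφ, hφψ⟩ :=
    exists_isogeny_baseChange_comp_eq_prime_smul_of_not_irreducible W hred K
  haveI := hW'
  haveI : (W.baseChange K).IsElliptic := inferInstanceAs (W.map (algebraMap ℚ K)).IsElliptic
  haveI : (W'.baseChange K).IsElliptic := inferInstanceAs (W'.map (algebraMap ℚ K)).IsElliptic
  exact ⟨W', hW', hiso, φ, ψ, hdeg, hψφ, hφψ, fun P hP hidx P' hidx' P₁ hP₁ hfin ↦
    exists_root_iff_dvd_index_point φ ψ hp hψφ hφψ P hP hidx P' hidx' P₁ hP₁ hfin⟩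

end Summit.BirchSwinnertonDyer.Rank1Residual.LW16.IsogenyEdge

end
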